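import Mathlib
import Literature.Computability.AlgebraicComplexity.NonscalarComputation

/-!
# Weighted truncation of nonscalar computations (`GraphEquations`, kernel M7)

Support module for the decomp-mm node «GraphEquations» (lens 5), attacked leaf
`MultiplicityReduction` (`Theses/GraphEquations.lean`).  Target of the node, VERBATIM:
`_root_.MatrixMultiplication` (`omega ℂ = 2`).

**What is here (route-independent, no `sorry`).**  Strassen's degree truncation of a nonscalar
straight-line program, in the WEIGHTED form and for an ARBITRARY truncation order `D`:

* `weightedHomogeneousComponent_mul` — the product formula
  `(u · v)_m = Σ_{i + j = m} u_i · v_j` for `ℕ`-valued weights;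
* `exists_weightedTruncation` — if `gs` is a nonscalar computation sequence
  (Ostrowski model, tree `IsNonscalarSeq`, newest first) and all weights are nonzero, then there is
  a nonscalar computation sequence `gs'` of length `≤ D · D · |gs|` such that every weighted
  homogeneous component of weighted degree `≤ D` of every polynomial in the cost-free span of `gs`
  lies in the cost-free span of `gs'`.

The tree's `IsNonscalarSeq.exists_quadratic_forms` (BCS Prop. (14.1)) is the case `D = 2`,
standard grading.  The higher-order, weighted version is what the INITIAL-FORM cost–rank inequality
(`GraphEquationsInitialForms`) consumes: with weights `w(a) = w(b) = 1`, `w(c) = 2` the generators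
`c_il − Σ_j a_ij b_jl` of the ideal of the graph `W_n` are weighted homogeneous, so the weighted
initial forms of the tests of an equation system are again cheap AND again vanish on the graph.

Sources: [Strassen1973] V. Strassen, *Vermeidung von Divisionen*, Crelle 264 (1973) 184–202
(homogeneous parts up to degree `d` cost a factor `≍ d²`); [BurgisserClausenShokrollahi1997]
Thm. (7.1), Prop. (14.1), §4.1 Rem. (4.3).
-/

set_option linter.dupNamespace false

noncomputable section

open scoped BigOperators

namespace Summit.MatrixMultiplication.MatrixMultiplication.Theorems.GraphEquations

open MvPolynomial
open Literature.Computability.AlgebraicComplexity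

universe u v

variable {R : Type u} [CommSemiring R] {σ : Type v}

/-! ## Weighted homogeneous components of `1`, variables and products -/

/-- `1` has only a weight-`0` component. -/
theorem weightedHomogeneousComponent_one (w : σ → ℕ) (m : ℕ) :
    weightedHomogeneousComponent w m (1 : MvPolynomial σ R) = if m = 0 then 1 else 0 :=
  weightedHomogeneousComponent_of_mem (isWeightedHomogeneous_one R w)

/-- A variable has only a weight-`w i` component. -/
theorem weightedHomogeneousComponent_X' (w : σ → ℕ) (m : ℕ) (i : σ) :
    weightedHomogeneousComponent w m (X i : MvPolynomial σ R) = if m = w i then X i else 0 :=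
  weightedHomogeneousComponent_of_mem (isWeightedHomogeneous_X R w i)

/-- **Product formula** `(u · v)_m = Σ_{i + j = m} u_i · v_j` (weights in `ℕ`). -/
theorem weightedHomogeneousComponent_mul (w : σ → ℕ) (m : ℕ) (u v : MvPolynomial σ R) :
    weightedHomogeneousComponent w m (u * v) =
      ∑ ij ∈ Finset.HasAntidiagonal.antidiagonal m,
        weightedHomogeneousComponent w ij.1 u * weightedHomogeneousComponent w ij.2 v := by
  classical
  ext d
  rw [coeff_weightedHomogeneousComponent, coeff_sum]
  simp_rw [coeff_mul, coeff_weightedHomogeneousComponent]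
  rw [Finset.sum_comm]
  have key : ∀ x ∈ Finset.HasAntidiagonal.antidiagonal d,
      (∑ ij ∈ Finset.HasAntidiagonal.antidiagonal m,
        (if Finsupp.weight w x.1 = ij.1 then coeff x.1 u else 0) *
          (if Finsupp.weight w x.2 = ij.2 then coeff x.2 v else 0)) =
      if Finsupp.weight w d = m then coeff x.1 u * coeff x.2 v else 0 := by
    intro x hx
    have hd : Finsupp.weight w x.1 + Finsupp.weight w x.2 = Finsupp.weight w d := by
      rw [← map_add, Finset.HasAntidiagonal.mem_antidiagonal.mp hx]
    have hterm : ∀ ij : ℕ × ℕ,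
        (if Finsupp.weight w x.1 = ij.1 then coeff x.1 u else 0) *
            (if Finsupp.weight w x.2 = ij.2 then coeff x.2 v else 0) =
          if (Finsupp.weight w x.1, Finsupp.weight w x.2) = ij then coeff x.1 u * coeff x.2 v else 0 := by
      intro ij
      by_cases h1 : Finsupp.weight w x.1 = ij.1 <;> by_cases h2 : Finsupp.weight w x.2 = ij.2 <;>
        simp [h1, h2, Prod.ext_iff]
    simp_rw [hterm]
    rw [Finset.sum_ite_eq]
    simp only [Finset.HasAntidiagonal.mem_antidiagonal, hd]
  rw [Finset.sum_congr rfl key]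
  split_ifs <;> simp

/-! ## Prepending products to a nonscalar sequence -/

/-- Prepending products whose factors are cost-free given `gs` keeps a nonscalar sequence. -/
theorem isNonscalarSeq_prependProducts {gs : List (MvPolynomial σ R)} (hgs : IsNonscalarSeq gs)
    (l : List (MvPolynomial σ R × MvPolynomial σ R))
    (hl : ∀ uv ∈ l, uv.1 ∈ freeSpan {x | x ∈ gs} ∧ uv.2 ∈ freeSpan {x | x ∈ gs}) :
    IsNonscalarSeq (l.map (fun uv => uv.1 * uv.2) ++ gs) := by
  induction l with
  | nil => simpa using hgs
  | cons a l ih =>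
    have ih' := ih fun uv huv => hl uv (List.mem_cons_of_mem _ huv)
    have hmono : freeSpan {x | x ∈ gs} ≤
        freeSpan {x | x ∈ l.map (fun uv => uv.1 * uv.2) ++ gs} :=
      freeSpan_mono fun x hx => by
        simp only [Set.mem_setOf_eq, List.mem_append]
        exact Or.inr hx
    obtain ⟨h1, h2⟩ := hl a List.mem_cons_self
    simp only [List.map_cons, List.cons_append]
    exact ⟨ih', a.1, hmono h1, a.2, hmono h2, rfl⟩

/-! ## Weighted truncation -/

/-- The weighted components of `1` are cost-free. -/
theorem weightedHomogeneousComponent_one_mem_freeSpan (w : σ → ℕ) (m : ℕ)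
    (S : Set (MvPolynomial σ R)) :
    weightedHomogeneousComponent w m (1 : MvPolynomial σ R) ∈ freeSpan S := by
  rw [weightedHomogeneousComponent_one]
  split_ifs
  · exact one_mem_freeSpan S
  · exact zero_mem _

/-- The weighted components of a variable are cost-free. -/
theorem weightedHomogeneousComponent_X_mem_freeSpan (w : σ → ℕ) (m : ℕ) (i : σ)
    (S : Set (MvPolynomial σ R)) :
    weightedHomogeneousComponent w m (X i : MvPolynomial σ R) ∈ freeSpan S := by
  rw [weightedHomogeneousComponent_X']
  split_ifs
  · exact X_mem_freeSpan S i
  · exact zero_mem _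

/-- **Weighted truncation of a nonscalar computation** (Strassen 1973; BCS Thm. (7.1),
Prop. (14.1), arbitrary order).  All weights nonzero.  For a nonscalar computation sequence `gs`
and an order `D` there is a nonscalar computation sequence `gs'`, `|gs'| ≤ D·D·|gs|`, whose
cost-free span contains every weighted homogeneous component of weighted degree `≤ D` of every
polynomial that is cost-free given `gs`. -/
theorem exists_weightedTruncation (w : σ → ℕ) (hw : ∀ i, w i ≠ 0) (D : ℕ)
    {gs : List (MvPolynomial σ R)} (hgs : IsNonscalarSeq gs) :
    ∃ gs' : List (MvPolynomial σ R), IsNonscalarSeq gs' ∧ gs'.length ≤ D * D * gs.length ∧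
      ∀ p ∈ freeSpan {x | x ∈ gs}, ∀ m ≤ D,
        weightedHomogeneousComponent w m p ∈ freeSpan {x | x ∈ gs'} := by
  classical
  induction gs with
  | nil =>
    refine ⟨[], isNonscalarSeq_nil, le_rfl, fun p hp m _ => ?_⟩
    refine apply_mem_of_mem_freeSpan (weightedHomogeneousComponent w m) ?_ ?_ ?_ hp
    · exact weightedHomogeneousComponent_one_mem_freeSpan w m _
    · exact fun i => weightedHomogeneousComponent_X_mem_freeSpan w m i _
    · intro s hs; simp at hs
  | cons g gs ih =>
    obtain ⟨hgs', u, hu, v, hv, rfl⟩ := hgs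
    obtain ⟨gs', hns', hlen', hmem'⟩ := ih hgs'
    -- the new sequence: the `D²` products of components, then `gs'`
    let l : List (MvPolynomial σ R × MvPolynomial σ R) :=
      ((List.range D) ×ˢ (List.range D)).map fun ij : ℕ × ℕ =>
        (weightedHomogeneousComponent w (ij.1 + 1) u, weightedHomogeneousComponent w (ij.2 + 1) v)
    have hl_len : l.length = D * D := by simp [l, List.length_product]
    have hl_mem : ∀ i j : ℕ, 1 ≤ i → i ≤ D → 1 ≤ j → j ≤ D →
        (weightedHomogeneousComponent w i u, weightedHomogeneousComponent w j v) ∈ l := by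
      intro i j hi hiD hj hjD
      simp only [l, List.mem_map]
      refine ⟨(i - 1, j - 1), ?_, ?_⟩
      · rw [List.mem_product]
        simp only [List.mem_range]
        omega
      · simp only
        rw [Nat.sub_add_cancel hi, Nat.sub_add_cancel hj]
    refine ⟨l.map (fun uv => uv.1 * uv.2) ++ gs', ?_, ?_, fun p hp m hm => ?_⟩
    · refine isNonscalarSeq_prependProducts hns' l fun uv huv => ?_
      simp only [l, List.mem_map] at huv
      obtain ⟨ij, hij, rfl⟩ := huv
      rw [List.mem_product] at hij
      simp only [List.mem_range] at hij
      exact ⟨hmem' u hu _ (by omega), hmem' v hv _ (by omega)⟩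
    · have h1 : (l.map (fun uv => uv.1 * uv.2) ++ gs').length = D * D + gs'.length := by
        simp [hl_len]
      rw [h1, List.length_cons]
      calc D * D + gs'.length ≤ D * D + D * D * gs.length := by omega
        _ = D * D * (gs.length + 1) := by ring
    · have hmono : freeSpan {x | x ∈ gs'} ≤
          freeSpan {x | x ∈ l.map (fun uv => uv.1 * uv.2) ++ gs'} :=
        freeSpan_mono fun x hx => by
          simp only [Set.mem_setOf_eq, List.mem_append]
          exact Or.inr hx
      refine apply_mem_of_mem_freeSpan (weightedHomogeneousComponent w m) ?_ ?_ ?_ hp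
      · exact weightedHomogeneousComponent_one_mem_freeSpan w m _
      · exact fun i => weightedHomogeneousComponent_X_mem_freeSpan w m i _
      intro s hs
      simp only [Set.mem_setOf_eq, List.mem_cons] at hs
      rcases hs with rfl | hs
      · -- the product: `(u v)_m = Σ_{i+j=m} u_i v_j`
        change weightedHomogeneousComponent w m (u * v) ∈ _
        rw [weightedHomogeneousComponent_mul]
        refine Submodule.sum_mem _ fun ij hij => ?_
        rw [Finset.HasAntidiagonal.mem_antidiagonal] at hij
        rcases Nat.eq_zero_or_pos ij.1 with hi | hi
        · -- `u_0 = C (coeff 0 u)`: a scalar multiple of `v_m`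
          rw [hi, weightedHomogeneousComponent_zero u hw, ← smul_eq_C_mul]
          exact Submodule.smul_mem _ _ (hmono (hmem' v hv _ (by omega)))
        rcases Nat.eq_zero_or_pos ij.2 with hj | hj
        · rw [hj, weightedHomogeneousComponent_zero v hw, mul_comm, ← smul_eq_C_mul]
          exact Submodule.smul_mem _ _ (hmono (hmem' u hu _ (by omega)))
        · -- a genuine new product
          refine mem_freeSpan_of_mem ?_
          simp only [Set.mem_setOf_eq, List.mem_append, List.mem_map]
          exact Or.inl ⟨_, hl_mem _ _ hi (by omega) hj (by omega), rfl⟩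
      · exact hmono (hmem' s (mem_freeSpan_of_mem hs) m hm)

/-- Packaged form over a length bound `N`, single degree. -/
theorem exists_weightedTruncation_of_span (w : σ → ℕ) (hw : ∀ i, w i ≠ 0) (D : ℕ) {N : ℕ}
    {ο : Type*} (p : ο → MvPolynomial σ R) (m : ο → ℕ) (hm : ∀ o, m o ≤ D)
    (h : ∃ gs : List (MvPolynomial σ R), IsNonscalarSeq gs ∧ gs.length ≤ N ∧
      ∀ o, p o ∈ freeSpan {q | q ∈ gs}) :
    ∃ gs' : List (MvPolynomial σ R), IsNonscalarSeq gs' ∧ gs'.length ≤ D * D * N ∧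
      ∀ o, weightedHomogeneousComponent w (m o) (p o) ∈ freeSpan {q | q ∈ gs'} := by
  obtain ⟨gs, hgs, hlen, hp⟩ := h
  obtain ⟨gs', hgs', hlen', hmem⟩ := exists_weightedTruncation w hw D hgs
  exact ⟨gs', hgs', hlen'.trans (Nat.mul_le_mul_left _ hlen), fun o => hmem _ (hp o) _ (hm o)⟩

end Summit.MatrixMultiplication.MatrixMultiplication.Theorems.GraphEquations

end
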